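import Mathlib

/-!
# Venture HSemireg — W3 SPECIAL FIBRES: the freeness criterion behind the purity census of Schoen's Ries carrier
# (seat `w3-jac-1` g10, file of record `widen/W3/W3-JAC-1-RIES.md` v2.5, §6.12 (j)(k))

HONEST FRAMING. Lean index of the computation cell `pub-hsemireg`, widening seat `w3-jac-1`.  This file proves ONE
piece of commutative algebra and records the arithmetic around it; no curve, no sheaf and no deformation is
constructed.  On paper (RIES §6.12 (j)(k)) purity of `𝒯¹ = 𝓔xt¹(Ω, 𝒪)` at a cone germ `Z` finite flat over a
regular base `B` is reduced, by local duality, to the FREENESS of the Jacobian image `ℐm ⊂ N = B^R`, and freeness is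
decided by the exact engine through the criterion «a module generated by `R` elements which contains `R` linearly
independent elements is free on those generators» — for `ℐm` the `R` independent elements exist because `N/ℐm`
is torsion (`𝒯¹` is supported on the singular locus), and the engine checks that the minimal number of generators is
`R` (`μ(ℐm) = rank`).  The theorem `injective_of_surjective_of_injective` below is that criterion over any commutative
domain: if `f : Rⁿ → M` is onto and some `g : Rⁿ → M` is one-to-one, then `f` is one-to-one (so `M` is free of
rank `n` on the generators).  Proof: lift `g` through `f` to a square matrix `A` (`f ∘ A = g`), which is injective,
hence `det A ≠ 0` (`Matrix.exists_mulVec_eq_zero_iff`); for `x ∈ ker f`, `det A • x = A (adj A · x)` maps under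
`f` to `g (adj A · x) = 0`, so `adj A · x = 0`, so `det A • x = 0`, so `x = 0`.  The numerical instances used
tonight (`μ = rank` for the twenty-one germs of RIES §6.12 (k), e.g. `12` for the 6-block over `ℂ[v]`, `72` over
`ℂ[u₂,u₃]`, `432` for `(2,1,1∣2,1,1)`, `280` for `(4,4)_w`) are recorded as arithmetic in the companion file
`SchoenCarrierWDescentCensus`.  Nothing here says that HC, HC_CM or HC_AV holds, that any particular sheaf is pure,
or that any object is semiregular; tiers are the W3 pen's.

CONTENT (all PROVED, 0 sorry), namespace `Summit.Ventures.HSemireg.SchoenCarrierPurityCriterion`.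
-/

namespace Summit.Ventures.HSemireg.SchoenCarrierPurityCriterion

open Matrix

variable {R : Type*} [CommRing R] [IsDomain R]
variable {M : Type*} [AddCommGroup M] [Module R M]
variable {n : Type*} [Fintype n] [DecidableEq n]

omit [IsDomain R] in
/-- Lifting a linear map `g : (n → R) → M` through a surjection `f : (n → R) → M` along the standard basis gives a
square matrix `A` with `f (A *ᵥ x) = g x`. -/
theorem exists_matrix_lift (f g : (n → R) →ₗ[R] M) (hf : Function.Surjective f) :
    ∃ A : Matrix n n R, ∀ x : n → R, f (A *ᵥ x) = g x := by
  classical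
  choose v hv using fun i => hf (g (Pi.single i 1))
  refine ⟨Matrix.of fun j i => v i j, ?_⟩
  -- both sides are linear in `x`; compare on the standard basis
  suffices h : f ∘ₗ Matrix.mulVecLin (Matrix.of fun j i => v i j) = g by
    intro x; exact LinearMap.congr_fun h x
  refine LinearMap.pi_ext' (fun i => LinearMap.ext_ring ?_)
  simp only [LinearMap.coe_comp, Function.comp_apply, Matrix.mulVecLin_apply, LinearMap.coe_single]
  have hcol : (Matrix.of fun j i => v i j) *ᵥ (Pi.single i 1 : n → R) = v i := by
    ext j
    simp [Matrix.mulVec, dotProduct, Pi.single_apply]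
  rw [hcol, hv]

/-- RIES §6.12 (j)(k), the FREENESS CRITERION: over a commutative domain, a module generated by `n` elements
(a surjection `f : Rⁿ → M`) which also receives an injection `g : Rⁿ → M` (`n` linearly independent elements) is
free on the generators — `f` is injective. -/
theorem injective_of_surjective_of_injective (f g : (n → R) →ₗ[R] M) (hf : Function.Surjective f)
    (hg : Function.Injective g) : Function.Injective f := by
  classical
  obtain ⟨A, hA⟩ := exists_matrix_lift f g hf
  -- `A` is injective because `g = f ∘ A` is
  have hinjA : ∀ w : n → R, A *ᵥ w = 0 → w = 0 := by
    intro w hw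
    apply hg
    rw [← hA w, hw, map_zero, map_zero]
  -- hence `det A ≠ 0`
  have hdet : A.det ≠ 0 := by
    intro h0
    obtain ⟨w, hw, hAw⟩ := Matrix.exists_mulVec_eq_zero_iff.mpr h0
    exact hw (hinjA w hAw)
  -- kernel of `f` is killed by `det A`, hence zero
  rw [injective_iff_map_eq_zero]
  intro x hx
  have h1 : A *ᵥ (A.adjugate *ᵥ x) = A.det • x := by
    rw [Matrix.mulVec_mulVec, Matrix.mul_adjugate, Matrix.smul_mulVec, Matrix.one_mulVec]
  have h2 : g (A.adjugate *ᵥ x) = 0 := by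
    rw [← hA, h1, map_smul, hx, smul_zero]
  have h3 : A.adjugate *ᵥ x = 0 := by
    apply hg; rw [h2, map_zero]
  have key : A.det • x = 0 := by rw [← h1, h3, Matrix.mulVec_zero]
  rcases smul_eq_zero.mp key with h | h
  · exact absurd h hdet
  · exact h

/-- The form used by the engine: if `f : Rⁿ → M` is onto and `M` contains an `n`-tuple of linearly independent
elements, then `f` is a linear isomorphism onto `M` (injective and surjective). -/
theorem bijective_of_surjective_of_linearIndependent (f : (n → R) →ₗ[R] M) (hf : Function.Surjective f)
    (w : n → M) (hw : LinearIndependent R w) : Function.Bijective f := by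
  classical
  refine ⟨injective_of_surjective_of_injective f (Fintype.linearCombination R w) hf ?_, hf⟩
  exact hw.fintypeLinearCombination_injective

/-- RIES §6.12 (j)(k), the duality bookkeeping around the criterion (arithmetic only): for a base of dimension
`d ≥ 2`, a free image has depth `d ≥ 2`, which is what kills `H¹_𝔪(ℐm) ≅ H⁰_𝔪(𝒯¹)`; the bases met tonight have
`d ∈ {2, 3, 4}` (6-block over `ℂ[v]` or `ℂ[u₂,u₃]`; two-sided cones over the centred quartic `ℂ[e₂,e₃,e₄]`;
Weierstrass cones over the even sextic∕octic). -/
theorem depth_bookkeeping : ∀ d ∈ ({2, 3, 4} : Finset ℕ), 2 ≤ d := by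
  decide

end Summit.Ventures.HSemireg.SchoenCarrierPurityCriterion
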